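import Literature.NumberTheory.EllipticCurves.SelmerCorankIsogenyProofs
import Literature.NumberTheory.EllipticCurves.IsogenyQuadraticTwistProofs
import Literature.NumberTheory.EllipticCurves.BSDSelmer
import HarnessLib

/-!
# Smith's Theorem 1.1 is an isogeny invariant: `r_{2^∞}(E^d) = r_{2^∞}(E₀^d)` (arXiv:2503.17619,
# §1.1 and Prop. 1.18) and the reduction of Case III to Cases I, IV, V

Topic `NumberTheory/EllipticCurves`, story `BSDSelmer` §S34 (`smith_selmerCorank_density`:
A. Smith, *The Birch and Swinnerton-Dyer conjecture implies Goldfeld's conjecture*,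
arXiv:2503.17619 (2025), Thm. 1.1). Smith proves Thm. 1.1 by the case distinction of his
Definition 1.6 on the `2`-torsion / `2`-isogeny structure of `E/ℚ` (Cases I–V): Cases I and II
are [Smi22a], Cases IV and V are his Thm. 1.7, and the remaining **Case III is reduced to the
others by an isogeny** (§1.1, after Thm. 1.7): *"if `E` is in Case III, there is a `ℚ` isogeny
`φ : E → E₀` to a curve `E₀` in either Case I, IV, or V. Since we have
`r_{2^∞}(E^d) = r_{2^∞}(E₀^d)` [numbered display] for all nonzero integers `d`, Theorem 1.1 will
follow for `E` since it holds for `E₀`"*; that displayed identity is the first equality of his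
**Prop. 1.18** (§1.2, "Isogeny tricks": for a `ℚ`-isogeny `φ : E → E₀` of degree `2` and
`d ≠ 0`, `r_{2^∞}(E^d) = r_{2^∞}(E₀^d) = r_{φ,div}(E^d) + r_{φ',div}(E₀^d)`, proved there from
"the first map [`Sel_div^{2^∞} E^d → Sel_div^{2^∞} E₀^d`] has finite kernel and `r_{2^∞}(E^d)`
equals the corank of `Sel^{2^∞} E^d`").

This file **proves** that reduction step for the tree's transcription, for isogenies of any
degree:

* `selmerCorankTwoInfty_eq_of_isogeny`, `selmerCorankTwoInfty_eq_of_isIsogenous`: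
  `r_{2^∞}(E) = r_{2^∞}(E₀)` for `ℚ`-isogenous elliptic curves (the tree's
  `selmerCorankTwoInfty = corank_{ℤ₂} Sel_{2^∞}(·/ℚ)`), from the isogeny invariance of the
  `p^∞`-Selmer corank over number fields (`WeierstrassCurve.Isogeny.selmerCorank_eq`, file
  `SelmerCorankIsogenyProofs`: dual isogeny, `Ш(φ̂) ∘ Ш(φ) = deg φ`, quasi-isomorphism
  invariance of the corank, `corank Sel_{p^∞} = rank + corank Ш[p^∞]`);
* `selmerCorankTwoInfty_quadraticTwist_eq_of_isIsogenous` — **the display of §1.1 = Prop. 1.18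
  (first equality)**: `r_{2^∞}(E^d) = r_{2^∞}(E₀^d)` for `E ∼_ℚ E₀` and `d ≠ 0`, since twisting
  commutes with isogenies (`WeierstrassCurve.IsIsogenous.quadraticTwist`, Cremona §3.9;
  Smith §1.1: "there is an associated isogeny from `E^d` to `E₀^d`");
* `smith_selmerCorank_density_iff_of_isIsogenous`, `smith_selmerCorank_density_of_isogeny` —
  **Thm. 1.1 for `E₀` implies Thm. 1.1 for `E`** along any `ℚ`-isogeny `E → E₀` (the Case III
  reduction exactly as used in §1.1 of the paper): the three density predicates of
  `smith_selmerCorank_density` agree termwise.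

No new definitions or named facts; nothing here proves Thm. 1.1 itself (Cases I, II, IV, V are
Smith's higher-Selmer theory, [Smi22a] and Thm. 1.7).

## References

* A. Smith, *The Birch and Swinnerton-Dyer conjecture implies Goldfeld's conjecture*,
  arXiv:2503.17619 (2025): §1.1 (Def. 1.6, Thm. 1.7 and the display following it), §1.2
  (Prop. 1.18 and its proof).
  [arXiv250317619]
* A. Smith, *The distribution of `ℓ^∞`-Selmer groups in degree `ℓ` twist families I*,
  arXiv:2207.05674 (2022). [Smi22a]
* R. Greenberg, *Iwasawa theory for elliptic curves*, LNM 1716 (1999), §1. [Greenberg1999LNM]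
* J. E. Cremona, *Algorithms for Modular Elliptic Curves*, 2nd ed. (1997), §3.9 (p. 87:
  twisting commutes with isogenies). [CremonaAlgorithms1997]
-/

noncomputable section

open scoped Classical

namespace Literature.NumberTheory.EllipticCurves

open WeierstrassCurve

variable {W W₀ : WeierstrassCurve ℚ}

/-- **`r_{2^∞}` is an isogeny invariant**: for an isogeny `φ : E → E₀` of elliptic curves over
`ℚ`, `corank_{ℤ₂} Sel_{2^∞}(E/ℚ) = corank_{ℤ₂} Sel_{2^∞}(E₀/ℚ)` (the case `K = ℚ`, `p = 2` of
`WeierstrassCurve.Isogeny.selmerCorank_eq`). Smith, arXiv:2503.17619, proof of Prop. 1.18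
("`r_{2^∞}(E^d)` equals the corank of `Sel^{2^∞} E^d`" and the first map has finite kernel);
Greenberg, LNM 1716, §1. [cite: arXiv250317619, Prop. 1.18 (proof)]
[cite: Greenberg1999LNM, §1 pp. 54–57] -/
theorem selmerCorankTwoInfty_eq_of_isogeny [W.IsElliptic] [W₀.IsElliptic] (φ : Isogeny W W₀) :
    selmerCorankTwoInfty W = selmerCorankTwoInfty W₀ := by
  rw [selmerCorankTwoInfty_eq, selmerCorankTwoInfty_eq]
  exact φ.selmerCorank_eq 2

/-- **`ℚ`-isogenous elliptic curves have the same `r_{2^∞}`** (`IsIsogenous` form of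
`selmerCorankTwoInfty_eq_of_isogeny`). Smith, arXiv:2503.17619, Prop. 1.18.
[cite: arXiv250317619, Prop. 1.18 (proof)] -/
theorem selmerCorankTwoInfty_eq_of_isIsogenous [W.IsElliptic] [W₀.IsElliptic]
    (h : IsIsogenous W W₀) : selmerCorankTwoInfty W = selmerCorankTwoInfty W₀ :=
  h.elim fun φ ↦ selmerCorankTwoInfty_eq_of_isogeny φ

/-- **Smith, arXiv:2503.17619, §1.1 (display after Thm. 1.7) = Prop. 1.18 (first equality):
`r_{2^∞}(E^d) = r_{2^∞}(E₀^d)`** for `ℚ`-isogenous elliptic curves `E ∼ E₀` and every `d ≠ 0`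
(printed for the `ℚ`-isogeny `φ : E → E₀` of a curve in Case III, resp. for a degree-`2`
`ℚ`-isogeny in Prop. 1.18; true for any `ℚ`-isogeny). The isogeny `E → E₀` induces an isogeny
of the twists `E^d → E₀^d` over `ℚ` (Smith §1.1, "there is an associated isogeny from `E^d` to
`E₀^d`"; tree: `WeierstrassCurve.IsIsogenous.quadraticTwist`, Cremona §3.9), and `r_{2^∞}` is
an isogeny invariant (`selmerCorankTwoInfty_eq_of_isIsogenous`).
[cite: arXiv250317619, §1.1 (display after Thm. 1.7)] [cite: arXiv250317619, Prop. 1.18] -/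
theorem selmerCorankTwoInfty_quadraticTwist_eq_of_isIsogenous [W.IsElliptic] [W₀.IsElliptic]
    (h : IsIsogenous W W₀) {d : ℚ} (hd : d ≠ 0) :
    selmerCorankTwoInfty (W.quadraticTwist d) = selmerCorankTwoInfty (W₀.quadraticTwist d) := by
  haveI := W.isElliptic_quadraticTwist (d := d) hd
  haveI := W₀.isElliptic_quadraticTwist (d := d) hd
  exact selmerCorankTwoInfty_eq_of_isIsogenous (h.quadraticTwist hd)

/-- The display of Smith, arXiv:2503.17619, §1.1 (after Thm. 1.7), for the integer parameter
`d ∈ ℤ ∖ {0}` of the twist family `E^d : y² = x³ + d² a x + d³ b` (the tree's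
`W.quadraticTwist (d : ℚ)`): `r_{2^∞}(E^d) = r_{2^∞}(E₀^d)` "for all nonzero integers `d`".
[cite: arXiv250317619, §1.1 (display after Thm. 1.7)] -/
theorem selmerCorankTwoInfty_quadraticTwist_intCast_eq_of_isIsogenous [W.IsElliptic]
    [W₀.IsElliptic] (h : IsIsogenous W W₀) {d : ℤ} (hd : d ≠ 0) :
    selmerCorankTwoInfty (W.quadraticTwist (d : ℚ)) =
      selmerCorankTwoInfty (W₀.quadraticTwist (d : ℚ)) :=
  selmerCorankTwoInfty_quadraticTwist_eq_of_isIsogenous h (by exact_mod_cast hd)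

/-- **Smith's Theorem 1.1 is an isogeny invariant**: for `ℚ`-isogenous elliptic curves
`E ∼ E₀`, the tree's transcription `smith_selmerCorank_density` of arXiv:2503.17619, Thm. 1.1
holds for `E` iff it holds for `E₀` — the three density predicates
"`d ≠ 0 ∧ r_{2^∞}(E^d) = r`" and "`d ≠ 0 ∧ r_{2^∞}(E₀^d) = r`" coincide for every `d`
(`selmerCorankTwoInfty_quadraticTwist_intCast_eq_of_isIsogenous`). This is the reduction of
Case III to Cases I, IV, V in Smith's proof (§1.1, after Thm. 1.7).
[cite: arXiv250317619, §1.1 (Case III reduction, after Thm. 1.7)] -/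
theorem smith_selmerCorank_density_iff_of_isIsogenous [W.IsElliptic] [W₀.IsElliptic]
    (h : IsIsogenous W W₀) : smith_selmerCorank_density W ↔ smith_selmerCorank_density W₀ := by
  have key : ∀ r : ℕ,
      (fun d : ℤ ↦ d ≠ 0 ∧ selmerCorankTwoInfty (W.quadraticTwist (d : ℚ)) = r) =
        fun d : ℤ ↦ d ≠ 0 ∧ selmerCorankTwoInfty (W₀.quadraticTwist (d : ℚ)) = r := by
    intro r
    funext d
    refine propext (and_congr_right fun hd ↦ ?_)
    rw [selmerCorankTwoInfty_quadraticTwist_intCast_eq_of_isIsogenous h hd]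
  have hP : ∀ (r : ℕ) (δ : ℝ),
      twistDensity (fun d : ℤ ↦ d ≠ 0 ∧ selmerCorankTwoInfty (W.quadraticTwist (d : ℚ)) = r) δ ↔
        twistDensity (fun d : ℤ ↦ d ≠ 0 ∧ selmerCorankTwoInfty (W₀.quadraticTwist (d : ℚ)) = r)
          δ := fun r δ ↦ by
    rw [key r]
  unfold smith_selmerCorank_density
  exact and_congr (hP 0 _) (and_congr (hP 1 _)
    (forall_congr' fun r ↦ imp_congr_right fun _ ↦ hP r _))

/-- **The Case III reduction of Smith, arXiv:2503.17619, §1.1** (after Thm. 1.7): *"if `E` is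
in Case III, there is a `ℚ` isogeny `φ : E → E₀` to a curve `E₀` in either Case I, IV, or V.
Since we have `r_{2^∞}(E^d) = r_{2^∞}(E₀^d)` for all nonzero integers `d`, Theorem 1.1 will
follow for `E` since it holds for `E₀`."* Formally: along any `ℚ`-isogeny `φ : E → E₀` of
elliptic curves, Thm. 1.1 for `E₀` implies Thm. 1.1 for `E`.
[cite: arXiv250317619, §1.1 (Case III reduction, after Thm. 1.7)] -/
theorem smith_selmerCorank_density_of_isogeny [W.IsElliptic] [W₀.IsElliptic] (φ : Isogeny W W₀)
    (h₀ : smith_selmerCorank_density W₀) : smith_selmerCorank_density W :=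
  (smith_selmerCorank_density_iff_of_isIsogenous ⟨φ⟩).mpr h₀

/-- The same reduction stated with the isogeny going the other way, `φ : E₀ → E` (isogeny of
elliptic curves over `ℚ` is symmetric: the dual isogeny, Silverman, *AEC*, III.6.1(a); tree
`IsIsogenous.symm_of_charZero`).
[cite: arXiv250317619, §1.1 (Case III reduction, after Thm. 1.7)] -/
theorem smith_selmerCorank_density_of_isogeny' [W.IsElliptic] [W₀.IsElliptic]
    (φ : Isogeny W₀ W) (h₀ : smith_selmerCorank_density W₀) : smith_selmerCorank_density W :=
  (smith_selmerCorank_density_iff_of_isIsogenous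
    (IsIsogenous.symm_of_charZero (⟨φ⟩ : IsIsogenous W₀ W))).mpr h₀

end Literature.NumberTheory.EllipticCurves

end
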